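import Mathlib
import Summits.Ventures.PercRepro2.Tail2DBlockCalc
import Summits.Ventures.PercRepro2.Tail2DHarrisSP
import Summits.Ventures.PercRepro2.Tail2DFlowOneBlocks
import Summits.Ventures.PercRepro2.Tail2DFlowOneStep01
import Summits.Ventures.PercRepro2.Tail2DParFin
import Summits.Ventures.PercRepro2.Tail2DParFinFlip
import Summits.Ventures.PercRepro2.Tail2DParFinTop
import Summits.Ventures.PercRepro2.Tail2DParFinDiag
import Summits.Ventures.PercRepro2.Tail2DParFinCount
import Summits.Ventures.PercRepro2.Tail2DParFinRelax
import Summits.Ventures.PercRepro2.Tail2DParFinSubTop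
import Summits.Ventures.PercRepro2.Tail2DParFinSubTopB
import Summits.Ventures.PercRepro2.Tail2DParFinFibres
import Summits.Ventures.PercRepro2.Tail2DOneChange
import Summits.Ventures.PercRepro2.Tail2DOneChangeB
import Summits.Ventures.PercRepro2.Tail2DOneChangeC
import Summits.Ventures.PercRepro2.Tail2DFourIdent

/-!
# (SD) at `(2,0)` on `6` identical flow-one factors — an explicit one-change table
(seat mine-b, cell pub-perc-repro2; conjectures/MINE-B.md §44)

The rates are `P(c/a)/D(c/a)` with `P` of non-negative coefficients (found by an LP on the coefficients, verified
exactly; mining/mine-b/code/g42/k67_tables.json), applied through the generic theorem `sdomZ_of_oneChange`.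
-/

namespace Summit.Ventures.PercRepro2.Tail2D

open V2Closure Finset

namespace IdentSix20

/-- `D = 62 * a ^ 4 + 180 * a ^ 3 * c + 210 * a ^ 2 * c ^ 2 + 120 * a * c ^ 3 + 30 * c ^ 4` at `(2,0)` on `6` identical factors -/
noncomputable def dN (Y : V2Closure.SP) : ℚ := 62 * aY Y ^ 4 + 180 * aY Y ^ 3 * cY Y + 210 * aY Y ^ 2 * cY Y ^ 2 + 120 * aY Y * cY Y ^ 3 + 30 * cY Y ^ 4

/-- the identity rate by the type `(#R, #B)` -/
noncomputable def ιN (Y : V2Closure.SP) (r b : ℕ) : ℚ :=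
  if r = 2 ∧ b = 1 then ((107 / 15 : ℚ) * aY Y ^ 5 + (349 / 10 : ℚ) * aY Y ^ 4 * cY Y + 95 * aY Y ^ 3 * cY Y ^ 2 + 40 * aY Y ^ 2 * cY Y ^ 3 + 5 * aY Y * cY Y ^ 4) / (aY Y * dN Y) else
  if r = 3 ∧ b = 1 then ((164 / 5 : ℚ) * aY Y ^ 5 + (897 / 10 : ℚ) * aY Y ^ 4 * cY Y + (225 / 2 : ℚ) * aY Y ^ 3 * cY Y ^ 2 + 50 * aY Y ^ 2 * cY Y ^ 3 + (15 / 2 : ℚ) * aY Y * cY Y ^ 4) / (aY Y * dN Y) else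
  if r = 4 ∧ b = 1 then ((223 / 5 : ℚ) * aY Y ^ 5 + 120 * aY Y ^ 4 * cY Y + 123 * aY Y ^ 3 * cY Y ^ 2 + 56 * aY Y ^ 2 * cY Y ^ 3 + 9 * aY Y * cY Y ^ 4) / (aY Y * dN Y) else
  if r = 5 ∧ b = 1 then ((140 / 3 : ℚ) * aY Y ^ 5 + 126 * aY Y ^ 4 * cY Y + 130 * aY Y ^ 3 * cY Y ^ 2 + 60 * aY Y ^ 2 * cY Y ^ 3 + 10 * aY Y * cY Y ^ 4) / (aY Y * dN Y) else
  if r = 2 ∧ b = 2 then ((563 / 15 : ℚ) * aY Y ^ 5 + (1247 / 15 : ℚ) * aY Y ^ 4 * cY Y + (1921 / 15 : ℚ) * aY Y ^ 3 * cY Y ^ 2 + (79 / 3 : ℚ) * aY Y ^ 2 * cY Y ^ 3) / (aY Y * dN Y) else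
  if r = 3 ∧ b = 2 then ((2731 / 60 : ℚ) * aY Y ^ 5 + (1513 / 12 : ℚ) * aY Y ^ 4 * cY Y + (714 / 5 : ℚ) * aY Y ^ 3 * cY Y ^ 2 + (189 / 4 : ℚ) * aY Y ^ 2 * cY Y ^ 3 + (9 / 2 : ℚ) * aY Y * cY Y ^ 4) / (aY Y * dN Y) else
  if r = 4 ∧ b = 2 then ((763 / 15 : ℚ) * aY Y ^ 5 + (672 / 5 : ℚ) * aY Y ^ 4 * cY Y + 133 * aY Y ^ 3 * cY Y ^ 2 + 56 * aY Y ^ 2 * cY Y ^ 3 + 7 * aY Y * cY Y ^ 4) / (aY Y * dN Y) else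
  if r = 2 ∧ b = 3 then ((196 / 5 : ℚ) * aY Y ^ 5 + (973 / 10 : ℚ) * aY Y ^ 4 * cY Y + (787 / 6 : ℚ) * aY Y ^ 3 * cY Y ^ 2 + 20 * aY Y ^ 2 * cY Y ^ 3) / (aY Y * dN Y) else
  if r = 3 ∧ b = 3 then ((973 / 20 : ℚ) * aY Y ^ 5 + (2603 / 20 : ℚ) * aY Y ^ 4 * cY Y + (1331 / 10 : ℚ) * aY Y ^ 3 * cY Y ^ 2 + 32 * aY Y ^ 2 * cY Y ^ 3) / (aY Y * dN Y) else
  if r = 2 ∧ b = 4 then ((196 / 5 : ℚ) * aY Y ^ 5 + (474 / 5 : ℚ) * aY Y ^ 4 * cY Y + (408 / 5 : ℚ) * aY Y ^ 3 * cY Y ^ 2 + 22 * aY Y ^ 2 * cY Y ^ 3) / (aY Y * dN Y) else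
  0

/-- the flip rate per red by the type -/
noncomputable def fN (Y : V2Closure.SP) (r b : ℕ) : ℚ :=
  if b = 0 then ((r : ℚ))⁻¹ else
  if r = 2 ∧ b = 1 then ((314 / 15 : ℚ) * aY Y ^ 5 + (991 / 20 : ℚ) * aY Y ^ 4 * cY Y + 26 * aY Y ^ 3 * cY Y ^ 2 + 20 * aY Y ^ 2 * cY Y ^ 3 + (15 / 2 : ℚ) * aY Y * cY Y ^ 4) / (aY Y * dN Y) else
  if r = 3 ∧ b = 1 then ((182 / 15 : ℚ) * aY Y ^ 3 * cY Y ^ 2 + (70 / 3 : ℚ) * aY Y ^ 2 * cY Y ^ 3 + (15 / 2 : ℚ) * aY Y * cY Y ^ 4) / (aY Y * dN Y) else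
  if r = 4 ∧ b = 1 then ((111 / 10 : ℚ) * aY Y ^ 3 * cY Y ^ 2 + 16 * aY Y ^ 2 * cY Y ^ 3 + (21 / 4 : ℚ) * aY Y * cY Y ^ 4) / (aY Y * dN Y) else
  if r = 5 ∧ b = 1 then ((46 / 15 : ℚ) * aY Y ^ 5 + (54 / 5 : ℚ) * aY Y ^ 4 * cY Y + 16 * aY Y ^ 3 * cY Y ^ 2 + 12 * aY Y ^ 2 * cY Y ^ 3 + 4 * aY Y * cY Y ^ 4) / (aY Y * dN Y) else
  if r = 2 ∧ b = 2 then ((1037 / 90 : ℚ) * aY Y ^ 5 + (1789 / 45 : ℚ) * aY Y ^ 4 * cY Y + (16 / 3 : ℚ) * aY Y ^ 3 * cY Y ^ 2 + (55 / 6 : ℚ) * aY Y ^ 2 * cY Y ^ 3 + 5 * aY Y * cY Y ^ 4) / (aY Y * dN Y) else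
  if r = 3 ∧ b = 2 then ((989 / 180 : ℚ) * aY Y ^ 5 + (343 / 180 : ℚ) * aY Y ^ 4 * cY Y + (173 / 12 : ℚ) * aY Y ^ 2 * cY Y ^ 3 + 5 * aY Y * cY Y ^ 4) / (aY Y * dN Y) else
  if r = 4 ∧ b = 2 then ((319 / 30 : ℚ) * aY Y ^ 3 * cY Y ^ 2 + (61 / 4 : ℚ) * aY Y ^ 2 * cY Y ^ 3 + 5 * aY Y * cY Y ^ 4) / (aY Y * dN Y) else
  if r = 2 ∧ b = 3 then ((5 / 4 : ℚ) * aY Y ^ 5 + (1487 / 60 : ℚ) * aY Y ^ 4 * cY Y + (23 / 4 : ℚ) * aY Y ^ 2 * cY Y ^ 3 + (15 / 4 : ℚ) * aY Y * cY Y ^ 4) / (aY Y * dN Y) else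
  if r = 3 ∧ b = 3 then ((47 / 15 : ℚ) * aY Y ^ 5 + (631 / 60 : ℚ) * aY Y ^ 4 * cY Y + (361 / 60 : ℚ) * aY Y ^ 3 * cY Y ^ 2 + (33 / 4 : ℚ) * aY Y ^ 2 * cY Y ^ 3 + (15 / 4 : ℚ) * aY Y * cY Y ^ 4) / (aY Y * dN Y) else
  if r = 2 ∧ b = 4 then (4 * aY Y ^ 2 * cY Y ^ 3 + 3 * aY Y * cY Y ^ 4) / (aY Y * dN Y) else
  0

/-- the relax rate per red by the type -/
noncomputable def xN (Y : V2Closure.SP) (r b : ℕ) : ℚ :=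
  if r = 2 ∧ b = 1 then ((13 / 2 : ℚ) * aY Y ^ 5 + (33 / 2 : ℚ) * aY Y ^ 4 * cY Y + 15 * aY Y ^ 3 * cY Y ^ 2 + 5 * aY Y ^ 2 * cY Y ^ 3) / (aY Y * dN Y) else
  if r = 3 ∧ b = 1 then ((146 / 15 : ℚ) * aY Y ^ 5 + (611 / 30 : ℚ) * aY Y ^ 4 * cY Y) / (aY Y * dN Y) else
  if r = 4 ∧ b = 1 then ((87 / 20 : ℚ) * aY Y ^ 5 + (213 / 20 : ℚ) * aY Y ^ 4 * cY Y) / (aY Y * dN Y) else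
  if r = 5 ∧ b = 1 then (0) / (aY Y * dN Y) else
  if r = 2 ∧ b = 2 then ((32 / 45 : ℚ) * aY Y ^ 5 + (239 / 30 : ℚ) * aY Y ^ 4 * cY Y + (83 / 3 : ℚ) * aY Y ^ 3 * cY Y ^ 2 + 10 * aY Y ^ 2 * cY Y ^ 3) / (aY Y * dN Y) else
  if r = 3 ∧ b = 2 then ((241 / 15 : ℚ) * aY Y ^ 4 * cY Y + (19 / 3 : ℚ) * aY Y ^ 3 * cY Y ^ 2 + (7 / 2 : ℚ) * aY Y ^ 2 * cY Y ^ 3) / (aY Y * dN Y) else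
  if r = 4 ∧ b = 2 then ((167 / 60 : ℚ) * aY Y ^ 5 + (517 / 60 : ℚ) * aY Y ^ 4 * cY Y + (3 / 4 : ℚ) * aY Y ^ 2 * cY Y ^ 3) / (aY Y * dN Y) else
  if r = 2 ∧ b = 3 then ((203 / 20 : ℚ) * aY Y ^ 5 + (77 / 12 : ℚ) * aY Y ^ 4 * cY Y + 33 * aY Y ^ 3 * cY Y ^ 2 + (45 / 4 : ℚ) * aY Y ^ 2 * cY Y ^ 3) / (aY Y * dN Y) else
  if r = 3 ∧ b = 3 then ((79 / 60 : ℚ) * aY Y ^ 5 + (287 / 60 : ℚ) * aY Y ^ 4 * cY Y + (89 / 6 : ℚ) * aY Y ^ 3 * cY Y ^ 2 + (25 / 4 : ℚ) * aY Y ^ 2 * cY Y ^ 3) / (aY Y * dN Y) else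
  if r = 2 ∧ b = 4 then ((57 / 5 : ℚ) * aY Y ^ 5 + (156 / 5 : ℚ) * aY Y ^ 4 * cY Y + 33 * aY Y ^ 3 * cY Y ^ 2 + 12 * aY Y ^ 2 * cY Y ^ 3) / (aY Y * dN Y) else
  0

/-- the rate table -/
noncomputable def ratesN (Y : V2Closure.SP) : OCRates 6 where
  ι := fun w => ιN Y (nR 6 w) (nB 6 w)
  f := fun w _ => fN Y (nR 6 w) (nB 6 w)
  x := fun w _ => xN Y (nR 6 w) (nB 6 w)

variable {Y : V2Closure.SP}

/-- `D > 0` -/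
theorem dN_pos (hR : 0 < (rSet Y).card) : 0 < dN Y := by
  unfold dN aY cY
  have : (0 : ℚ) < (rSet Y).card := by exact_mod_cast hR
  positivity

/-- non-negativity of the rates -/
theorem ιN_nonneg (hR : 0 < (rSet Y).card) (r b : ℕ) : 0 ≤ ιN Y r b := by
  have := dN_pos hR
  have ha : (0 : ℚ) < aY Y := by unfold aY; exact_mod_cast hR
  have hc : (0 : ℚ) ≤ cY Y := by unfold cY; positivity
  unfold ιN
  split_ifs <;> positivity

/-- non-negativity of the rates -/
theorem ratesN_iota_nonneg (hR : 0 < (rSet Y).card) (w : Fin 6 → Ltr) : 0 ≤ (ratesN Y).ι w :=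
  ιN_nonneg hR _ _

/-- non-negativity of the rates -/
theorem fN_nonneg (hR : 0 < (rSet Y).card) (r b : ℕ) : 0 ≤ fN Y r b := by
  have := dN_pos hR
  have ha : (0 : ℚ) < aY Y := by unfold aY; exact_mod_cast hR
  have hc : (0 : ℚ) ≤ cY Y := by unfold cY; positivity
  unfold fN
  by_cases h0 : b = 0
  · rw [if_pos h0]; positivity
  · rw [if_neg h0]; split_ifs <;> positivity

/-- non-negativity of the rates -/
theorem ratesN_f_nonneg (hR : 0 < (rSet Y).card) (w : Fin 6 → Ltr) (i : Fin 6) : 0 ≤ (ratesN Y).f w i :=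
  fN_nonneg hR _ _

/-- non-negativity of the rates -/
theorem xN_nonneg (hR : 0 < (rSet Y).card) (r b : ℕ) : 0 ≤ xN Y r b := by
  have := dN_pos hR
  have ha : (0 : ℚ) < aY Y := by unfold aY; exact_mod_cast hR
  have hc : (0 : ℚ) ≤ cY Y := by unfold cY; positivity
  unfold xN
  split_ifs <;> positivity

/-- non-negativity of the rates -/
theorem ratesN_x_nonneg (hR : 0 < (rSet Y).card) (w : Fin 6 → Ltr) (i : Fin 6) : 0 ≤ (ratesN Y).x w i :=
  xN_nonneg hR _ _

/-- `|E(2,0)|` -/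
theorem tailCountN_src (hY : FlowOne Y) : (tailCount (parFin 6 (fun _ => Y)) 2 0 : ℚ) = aY Y ^ 2 * (57 * aY Y ^ 4 + 156 * aY Y ^ 3 * cY Y + 165 * aY Y ^ 2 * cY Y ^ 2 + 80 * aY Y * cY Y ^ 3 + 15 * cY Y ^ 4) := by
  rw [tailCount_parFin_ident 6 Y hY 2 0]
  unfold aY cY
  simp only [Finset.sum_range_succ, Finset.sum_range_zero]
  norm_num [Nat.choose]
  ring

/-- `|E(1,1)|` -/
theorem tailCountN_tgt (hY : FlowOne Y) : (tailCount (parFin 6 (fun _ => Y)) 1 1 : ℚ) = aY Y ^ 2 * dN Y := by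
  rw [tailCount_parFin_ident 6 Y hY 1 1]
  unfold dN aY cY
  simp only [Finset.sum_range_succ, Finset.sum_range_zero]
  norm_num [Nat.choose]
  ring

/-- `γ_i = c/a` -/
theorem gamN (i : Fin 6) : gam 6 (fun _ => Y) i = cY Y / aY Y := rfl


end IdentSix20

end Summit.Ventures.PercRepro2.Tail2D
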